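import Literature.MathematicalPhysics.QuantumFieldTheory.Balaban1983to89.B15Prop1ChartSU2
import Literature.Analysis.Calculus.ExpDifferentialAdSeries
import Mathlib.Analysis.InnerProductSpace.Calculus
import Mathlib.Analysis.SpecialFunctions.Trigonometric.InverseDeriv

/-!
# `Balaban1983to89.B15Prop1ChartCalculusSU2` — [Balaban1989LargeFieldII] p. 359 *«we can write V′ = exp iB′. We expand the
# function with respect to B′ … the condition for a critical configuration is the equation (1.12)»*: THE ONE-BOND DIFFERENTIAL
# CALCULUS OF THE `SU(2)` EXPONENTIAL CHART — the chart change between print's coordinates `B′ ↦ exp(i(B′ + sδB′))` and the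
# left-multiplicative variations `s ↦ exp(isA)·V` of the carrier's `IsCriticalPt`, as DERIVATIVES

statement-level skeleton of published theorems with citation tags; proofs where landed; nothing here is a claim about
the Yang–Mills mass gap

Cell pub-ymgap, HUMAN RULING D-0062 (Track A full width), seat `pub-ymgap-dag-n12-c` (R134 acceleration seat (a), strategy s1 of DAG
node N12 = [B15]; generation g4, first product).  PDFs held: `paper:balaban1989-cmp122-large-field-ii` (journal page = PDF page +
354; p. 359 = PDF 5).

THE PRINT AND THE LETTER IT LEAVES.  [LF-II] p. 359: *«Fixing the gauge G₀ for V′ we get a small configuration, and we can write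
V′ = exp iB′. We expand the function with respect to B′ … Now the condition for a critical configuration is the equation (1.12)»*.
The N12∕s1 chain (`B15Prop1AdjointOfRecord.exists_domain_prop1Printed_lfVarOn_std_su2_box`, p485420) displays this sentence as
the letter (c3) `hc3`: at a chart point `V = exp(i·ιA B)·Ṽ` of the ball, the carrier's criticality `B15Prop1Carrier.IsCriticalPt`
(every LEFT-MULTIPLICATIVE variation `s ↦ f(exp(isA)·V)`, `A` supported on the bonds of `Λ`, is stationary) is EQUIVALENT to the
stationarity of print's coordinate variations `s ↦ f(exp(i·ιA(B + sδB))·Ṽ)`.  The two families of curves differ by the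
differential of the exponential map; this file supplies the one-bond calculus that converts one into the other, at the cell's
concrete group `SU(2)` (chart `B15Prop1ChartSU2.su2Chart`: `exp iX = expPoint X`, `(1/i) log U = logVec (su2Quat U)`, Lie algebra
`ℝ³`), entirely inside the quaternions `ℍ` (pv26's `su2Quat`, `imQuat = ι`, `imVec`, `exp_imQuat`).

WHAT THIS FILE PROVES (Mathlib + the two Literature imports; no `sorry`, no `… : Prop` fact, no `instance`, no `notation`; the
`def`s are explicit linear maps ∕ curves with bodies; axioms standard).
§1 `imVecL : ℍ →L[ℝ] ℝ³` (the imaginary vector as a continuous linear map, `imVec_imQuat : imVec (ι v) = v`); the ARCSINE LIFT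
   `asinLift v = (arcsin ‖v‖ ∕ ‖v‖)·v` with `‖asinLift v − v‖ = |arcsin ‖v‖ − ‖v‖|` and **`hasFDerivAt_asinLift_zero`** (derivative
   `id` at `0`, from `arcsin′(0) = 1`); **`logVec_eq_asinLift`**: on unit quaternions with `re q ≥ 0` the chart logarithm IS
   `asinLift ∘ imVec` (`arccos re q = arcsin |im q|`).
§2 LOGARITHM ALONG UNIT CURVES THROUGH `1`: for `q : ℝ → ℍ` with `‖q s‖ = 1`, `q 0 = 1`, `q′(0) = w`:
   **`hasDerivAt_logVec_of_unit`** (`(logVec ∘ q)′(0) = imVec w`) and `re_eq_zero_of_unit` (`re w = 0`, from `‖q‖² ≡ 1`).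
§3 THE DIFFERENTIAL OF `z ↦ exp(ιz)`: `dexpIm x : ℝ³ →L[ℝ] ℍ` (= r-p28's `ExpDifferential.dexp ℝ (ιx) ∘ ι`, Varadarajan 2.14.3 BY
   NAME), `hasFDerivAt_exp_imQuat`, `hasDerivAt_exp_imQuat_line` (`d/ds exp(ι(x + sy))|₀ = dexpIm x y`), and
   **`dexpIm_injective`** for `‖x‖ ≤ 1/2` (`D exp_X = e^X g(ad X)`, `g(ad X)` a unit for `‖ad X‖ ≤ 2‖X‖ ≤ 1`:
   `ExpDifferential.isUnit_gSer`).
§4 THE CHART-CHANGE MAP `theta x : ℝ³ →ₗ[ℝ] ℝ³`, `theta x y = imVec (dexpIm x y · exp(ιx)⁻¹)`: **`hasDerivAt_logVec_expLine`**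
   (`d/ds logVec(exp(ι(x+sy))·exp(ιx)⁻¹)|₀ = theta x y`), `theta_injective` ∕ **`theta_bijective`** for `‖x‖ ≤ 1/2`.
§5 AT THE CHART `su2Chart`: the bond curve `chartCurve x y s = (1/i)log(exp i(x+sy)·(exp ix)⁻¹)` with `exp i(chartCurve s)·exp ix
   = exp i(x+sy)` (**`iexp_chartCurve_mul`**, global) and **`hasDerivAt_chartCurve`** (`= theta x y` at `0`); the gauge curve
   `gaugeCurve g l₁ l₂ s = (1/i)log(exp(isl₁)·g·exp(isl₂)⁻¹·g⁻¹)` with **`iexp_gaugeCurve_mul`** and **`hasDerivAt_gaugeCurve`**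
   (`= l₁ − Ad_g l₂` at `0`, `Ad_g = B15Prop1ChartSU2.adSU2 g`) — the infinitesimal gauge transformation of one bond.

HONEST SCOPE.  (i) Pure chart calculus at `SU(2)`; nothing of Proposition 1 is asserted; the lattice-level use (criticality in all
directions ⇔ criticality in print's gauge-fixed coordinates) is the companion `B15Prop1CriticalViaSlice`.  (ii) The radius `1/2`
(from `‖ad X‖ ≤ 2‖X‖ ≤ 1`, the tree's inversion domain of `g`) is far from optimal (`d exp` is injective for `‖x‖ < π`); print only
needs *«B′ small»*.  (iii) Real chart only.  Count-neutral; NOT a discharge of N12; NOT summit progress; nothing continuum ∕ OS ∕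
mass-gap ∕ Clay.
-/

noncomputable section

open Set NormedSpace Filter
open scoped Real Quaternion Topology

namespace Literature.MathematicalPhysics.QuantumFieldTheory.Balaban1983to89.B15Prop1ChartCalculusSU2

open Literature.MathematicalPhysics.QuantumLattice (su2Quat quatToSU2 norm_su2Quat quatToSU2_su2Quat su2Quat_ne_zero)
open B16Sect1Backgrounds B15Prop1ChartSU2
open T4CubeChartGnomonic (SU2)
open T4HaarSU2ExpChart (imQuat imQuat_apply imQuat_re imQuat_imI imQuat_imJ imQuat_imK norm_imQuat norm_exp_imQuat expPoint
  expPoint_zero su2Quat_expPoint imQuat_injective)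
open T4ExpWindowSmallField (imVec imVec_apply_zero imVec_apply_one imVec_apply_two imQuat_imVec logVec norm_logVec
  norm_imVec_sq_of_norm_eq_one)
open T4HaarSU2Translate (su2Quat_mul su2Quat_one)
open Literature.Analysis.Calculus.ExpDifferential (dexp dexp_apply ad norm_ad_le gSer gInv gInv_mul_gSer exp_neg_mul_exp_eq_one
  hasFDerivAt_exp_dexp)

/-- Shorthand for the Lie algebra `ℝ³` of the `SU(2)` chart (pv26's model of `𝔰𝔲(2)`). [folklore] -/
abbrev E3 : Type := EuclideanSpace ℝ (Fin 3)

/-! ## §1 `imVec` as a continuous linear map, the arcsine lift, and the chart logarithm near `1` -/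

/-- `imVec` is additive. [folklore] -/
private theorem imVec_add (p q : ℍ) : imVec (p + q) = imVec p + imVec q := by
  ext i
  fin_cases i <;> simp [imVec]

/-- `imVec` is homogeneous. [folklore] -/
private theorem imVec_smul (c : ℝ) (p : ℍ) : imVec (c • p) = c • imVec p := by
  ext i
  fin_cases i <;> simp [imVec]

/-- **`imVec` AS A CONTINUOUS LINEAR MAP** `ℍ →L[ℝ] ℝ³` (finite dimensions). [folklore] -/
def imVecL : ℍ →L[ℝ] E3 :=
  LinearMap.toContinuousLinearMap { toFun := imVec, map_add' := imVec_add, map_smul' := imVec_smul }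

/-- `imVecL q = imVec q`. [cite: Balaban1989LargeFieldII, (1.16) p.360] -/
@[simp] theorem imVecL_apply (q : ℍ) : imVecL q = imVec q := rfl

/-- `imVec` respects subtraction. [folklore] -/
private theorem imVec_sub (p q : ℍ) : imVec (p - q) = imVec p - imVec q := map_sub imVecL p q

/-- `imVec (ι v) = v` (the chart coordinate of `exp(ιv)` to first order). [cite: Balaban1989LargeFieldII, (1.16) p.360] -/
@[simp] theorem imVec_imQuat (v : E3) : imVec (imQuat v) = v := by
  ext i
  fin_cases i <;> simp [imVec, imQuat_apply]

/-- `imVec 1 = 0`. [folklore] -/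
@[simp] private theorem imVec_one : imVec (1 : ℍ) = 0 := by
  ext i
  fin_cases i <;> simp [imVec]

/-- A quaternion with vanishing real part and vanishing imaginary vector is `0`. [folklore] -/
private theorem eq_zero_of_re_of_imVec {q : ℍ} (hre : q.re = 0) (him : imVec q = 0) : q = 0 := by
  have hI : q.imI = 0 := by simpa using congrArg (fun x : E3 => x 0) him
  have hJ : q.imJ = 0 := by simpa using congrArg (fun x : E3 => x 1) him
  have hK : q.imK = 0 := by simpa using congrArg (fun x : E3 => x 2) him
  ext <;> simp [hre, hI, hJ, hK]

/-- **THE ARCSINE LIFT** `asinLift v = (arcsin ‖v‖ ∕ ‖v‖)·v` on `ℝ³` (`= 0` at `v = 0` by `0/0 = 0`): the chart logarithm of a unit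
quaternion near `1` read on its imaginary vector (`logVec_eq_asinLift`). [folklore] -/
def asinLift (v : E3) : E3 := (Real.arcsin ‖v‖ / ‖v‖) • v

/-- `asinLift 0 = 0`. [folklore] -/
@[simp] private theorem asinLift_zero : asinLift 0 = 0 := by simp [asinLift]

/-- `‖asinLift v − v‖ = |arcsin ‖v‖ − ‖v‖|`. [folklore] -/
private theorem norm_asinLift_sub (v : E3) : ‖asinLift v - v‖ = |Real.arcsin ‖v‖ - ‖v‖| := by
  by_cases hv : v = 0
  · simp [hv]
  · have hn : ‖v‖ ≠ 0 := norm_ne_zero_iff.2 hv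
    have h1 : asinLift v - v = ((Real.arcsin ‖v‖ - ‖v‖) / ‖v‖) • v := by
      rw [asinLift, sub_div, div_self hn, sub_smul, one_smul]
    rw [h1, norm_smul, Real.norm_eq_abs, abs_div, abs_of_pos (norm_pos_iff.2 hv), div_mul_cancel₀ _ hn]

/-- **`asinLift` HAS DERIVATIVE `id` AT `0`** (`arcsin u − u = o(u)`). [cite: Balaban1989LargeFieldII, (1.16) p.360] -/
theorem hasFDerivAt_asinLift_zero : HasFDerivAt asinLift (ContinuousLinearMap.id ℝ E3) 0 := by
  rw [hasFDerivAt_iff_isLittleO_nhds_zero]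
  simp only [zero_add, asinLift_zero, sub_zero, ContinuousLinearMap.id_apply]
  have h1 : (fun u : ℝ => Real.arcsin u - u) =o[𝓝 0] fun u => u := by
    have hd := Real.hasDerivAt_arcsin (x := 0) (by norm_num) (by norm_num)
    rw [hasDerivAt_iff_isLittleO] at hd
    refine (hd.congr' ?_ ?_)
    · exact Eventually.of_forall fun u => by simp
    · exact Eventually.of_forall fun u => by simp
  have h2 : (fun v : E3 => Real.arcsin ‖v‖ - ‖v‖) =o[𝓝 0] fun v => ‖v‖ :=
    h1.comp_tendsto tendsto_norm_zero
  refine Asymptotics.IsLittleO.of_norm_right (Asymptotics.IsLittleO.of_norm_left ?_)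
  have h3 := h2.norm_left
  refine h3.congr' (Eventually.of_forall fun v => ?_) EventuallyEq.rfl
  show ‖Real.arcsin ‖v‖ - ‖v‖‖ = ‖asinLift v - v‖
  rw [norm_asinLift_sub, Real.norm_eq_abs]

/-- **THE CHART LOGARITHM NEAR `1` IS THE ARCSINE LIFT OF THE IMAGINARY VECTOR**: for a unit quaternion with `re q ≥ 0`,
`logVec q = asinLift (imVec q)` (`arccos (re q) = arcsin √(1 − re²) = arcsin ‖im q‖`). [cite: Balaban1989LargeFieldII, (1.16) p.360] -/
theorem logVec_eq_asinLift {q : ℍ} (hq : ‖q‖ = 1) (hre : 0 ≤ q.re) : logVec q = asinLift (imVec q) := by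
  have hsq := norm_imVec_sq_of_norm_eq_one hq
  unfold logVec
  split_ifs with h
  · -- the pole `im q = 0`: `re q = 1`
    have h0 : ‖imVec q‖ ^ 2 = 0 := by rw [h, norm_zero]; ring
    have hre1 : q.re = 1 := by nlinarith [hsq, h0, hre]
    rw [hre1, Real.arccos_one, zero_smul, h, asinLift_zero]
  · rw [asinLift, Real.arccos_eq_arcsin hre]
    have : Real.sqrt (1 - q.re ^ 2) = ‖imVec q‖ := by rw [← hsq, Real.sqrt_sq (norm_nonneg _)]
    rw [this]

/-! ## §2 The logarithm along unit curves through `1` -/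

/-- **LOGARITHM ALONG A UNIT CURVE THROUGH `1`**: if `q : ℝ → ℍ` takes unit values, `q 0 = 1` and `q′(0) = w`, then
`s ↦ logVec (q s)` is differentiable at `0` with derivative `imVec w` (near `s = 0`, `re (q s) > 0`, so `logVec ∘ q = asinLift ∘
imVec ∘ q`, and `D asinLift(0) = id`). [cite: Balaban1989LargeFieldII, (1.16) p.360] -/
theorem hasDerivAt_logVec_of_unit {q : ℝ → ℍ} {w : ℍ} (hq : ∀ s, ‖q s‖ = 1) (h0 : q 0 = 1) (hd : HasDerivAt q w 0) :
    HasDerivAt (fun s => logVec (q s)) (imVec w) 0 := by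
  have hcont : ContinuousAt (fun s => (q s).re) 0 := Quaternion.continuous_re.continuousAt.comp hd.continuousAt
  have hpos : (0 : ℝ) < (q 0).re := by rw [h0]; simp
  have hre : ∀ᶠ s in 𝓝 (0 : ℝ), 0 ≤ (q s).re := (hcont.eventually (lt_mem_nhds hpos)).mono fun s hs => hs.le
  have heq : (fun s => asinLift (imVecL (q s))) =ᶠ[𝓝 0] fun s => logVec (q s) :=
    hre.mono fun s hs => by
      show asinLift (imVec (q s)) = logVec (q s)
      rw [← logVec_eq_asinLift (hq s) hs]
  have h2 : HasDerivAt (fun s => imVecL (q s)) (imVecL w) 0 := imVecL.hasFDerivAt.comp_hasDerivAt 0 hd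
  have hq0 : imVecL (q 0) = 0 := by rw [h0, imVecL_apply, imVec_one]
  have hΦ : HasFDerivAt asinLift (ContinuousLinearMap.id ℝ E3) (imVecL (q 0)) := by
    rw [hq0]; exact hasFDerivAt_asinLift_zero
  have h3 := hΦ.comp_hasDerivAt 0 h2
  rw [ContinuousLinearMap.id_apply, imVecL_apply] at h3
  exact h3.congr_of_eventuallyEq heq.symm

/-- Along a unit curve through `1` the velocity is purely imaginary: `re (q′(0)) = 0` (differentiate `‖q s‖² ≡ 1`:
`2⟪q 0, q′(0)⟫ = 2 re (q′(0))⁎ = 0`). [cite: Balaban1989LargeFieldII, (1.16) p.360] -/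
theorem re_eq_zero_of_unit {q : ℝ → ℍ} {w : ℍ} (hq : ∀ s, ‖q s‖ = 1) (h0 : q 0 = 1) (hd : HasDerivAt q w 0) : w.re = 0 := by
  have h := hd.norm_sq
  have hc : HasDerivAt (fun s : ℝ => ‖q s‖ ^ 2) 0 0 := by
    have : (fun s : ℝ => ‖q s‖ ^ 2) = fun _ => 1 := by funext s; rw [hq s, one_pow]
    rw [this]; exact hasDerivAt_const 0 1
  have h2 : 2 * inner ℝ (q 0) w = 0 := h.unique hc
  rw [h0, Quaternion.inner_def] at h2
  simpa using h2

/-! ## §3 The differential of `z ↦ exp(ιz)` and its injectivity for `‖x‖ ≤ 1/2` -/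

/-- `ι = imQuat` as a continuous linear map `ℝ³ →L[ℝ] ℍ`. [folklore] -/
def imQuatL : E3 →L[ℝ] ℍ := LinearMap.toContinuousLinearMap imQuat

/-- `imQuatL v = ι v`. [folklore] -/
@[simp] private theorem imQuatL_apply (v : E3) : imQuatL v = imQuat v := rfl

/-- **THE DIFFERENTIAL OF `z ↦ exp(ιz)` AT `x`**: `dexpIm x = D exp_{ιx} ∘ ι : ℝ³ →L[ℝ] ℍ`, `D exp` the tree's
`ExpDifferential.dexp` (Varadarajan, Thm. 2.14.3; [Balaban1985Averaging] (32)). [cite: Balaban1985Averaging, (32)–(34) p.22] -/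
def dexpIm (x : E3) : E3 →L[ℝ] ℍ := (dexp ℝ (imQuat x)).comp imQuatL

/-- `dexpIm x y = D exp_{ιx}(ιy)`. [folklore] -/
private theorem dexpIm_apply (x y : E3) : dexpIm x y = dexp ℝ (imQuat x) (imQuat y) := rfl

/-- `z ↦ exp(ιz)` has Fréchet derivative `dexpIm x` at `x`. [cite: Balaban1985Averaging, (32)–(34) p.22] -/
theorem hasFDerivAt_exp_imQuat (x : E3) : HasFDerivAt (fun z : E3 => exp (imQuat z)) (dexpIm x) x :=
  (hasFDerivAt_exp_dexp (𝕂 := ℝ) (imQuat x)).comp x imQuatL.hasFDerivAt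

/-- The affine curve `s ↦ x + s·y` has velocity `y`. [folklore] -/
private theorem hasDerivAt_line (x y : E3) : HasDerivAt (fun s : ℝ => x + s • y) y 0 := by
  have h := ((hasDerivAt_id (0 : ℝ)).smul_const y).const_add x
  rwa [one_smul] at h

/-- **ALONG A LINE**: `d/ds exp(ι(x + s·y))|_{s=0} = dexpIm x y`. [cite: Balaban1985Averaging, (32)–(34) p.22] -/
theorem hasDerivAt_exp_imQuat_line (x y : E3) : HasDerivAt (fun s : ℝ => exp (imQuat (x + s • y))) (dexpIm x y) 0 :=
  (hasFDerivAt_exp_imQuat x).comp_hasDerivAt_of_eq 0 (hasDerivAt_line x y) (by rw [zero_smul, add_zero])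

/-- `‖ad (ιx)‖ ≤ 1` when `‖x‖ ≤ 1/2` (`‖ad X‖ ≤ 2‖X‖`, `‖ιx‖ = ‖x‖`). [folklore] -/
private theorem norm_ad_imQuat_le {x : E3} (hx : ‖x‖ ≤ 1 / 2) : ‖ad ℝ (imQuat x)‖ ≤ 1 :=
  (norm_ad_le (𝕂 := ℝ) (imQuat x)).trans (by rw [norm_imQuat]; linarith)

/-- **`dexpIm x` IS INJECTIVE FOR `‖x‖ ≤ 1/2`**: `D exp_X(h) = e^X·g(ad X)h` with `g(ad X)` invertible (`‖ad X‖ ≤ 1`,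
`ExpDifferential.gInv_mul_gSer`) and `e^X` invertible, composed with the injective `ι`. [cite: Balaban1985Averaging, (32)–(34) p.22] -/
theorem dexpIm_injective {x : E3} (hx : ‖x‖ ≤ 1 / 2) : Function.Injective (dexpIm x) := by
  refine (injective_iff_map_eq_zero (dexpIm x)).2 fun y hy => ?_
  have had := norm_ad_imQuat_le hx
  rw [dexpIm_apply, dexp_apply] at hy
  -- `e^X · g(ad X)(ιy) = 0 ⇒ g(ad X)(ιy) = 0`
  have h1 : gSer ℝ (ad ℝ (imQuat x)) (imQuat y) = 0 := by
    have := congrArg (fun q => exp (-imQuat x) * q) hy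
    simpa only [← mul_assoc, exp_neg_mul_exp_eq_one (𝕂 := ℝ) (imQuat x), one_mul, mul_zero] using this
  -- `ιy = g⁻¹(g(ιy)) = 0`
  have h2 : imQuat y = 0 := by
    have h3 : (gInv ℝ (ad ℝ (imQuat x)) * gSer ℝ (ad ℝ (imQuat x))) (imQuat y) = (1 : ℍ →L[ℝ] ℍ) (imQuat y) := by
      rw [gInv_mul_gSer (𝕂 := ℝ) had]
    have h4 : gInv ℝ (ad ℝ (imQuat x)) (gSer ℝ (ad ℝ (imQuat x)) (imQuat y)) = imQuat y := h3
    rw [h1, map_zero] at h4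
    exact h4.symm
  exact imQuat_injective (by rw [h2, map_zero])

/-! ## §4 The chart-change map `theta x` -/

/-- `exp(ιx)` is a unit quaternion, hence non-zero. [folklore] -/
private theorem exp_imQuat_ne_zero (x : E3) : exp (imQuat x) ≠ 0 := by
  intro h; have := norm_exp_imQuat x; rw [h, norm_zero] at this; exact zero_ne_one this

/-- **THE CHART-CHANGE MAP** `theta x : ℝ³ →ₗ[ℝ] ℝ³`, `theta x y = imVec (dexpIm x y · exp(ιx)⁻¹)` — the velocity, in the Lie
algebra `ℝ³`, of the LEFT quotient curve `s ↦ exp(ι(x+sy))·exp(ιx)⁻¹` (which passes through `1`): the coefficient converting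
print's coordinate variation `B′ + sδB′` on one bond into a left-multiplicative variation `exp(isA)·V` of the carrier.
[cite: Balaban1989LargeFieldII, p.359 («we can write V′ = exp iB′. We expand the function with respect to B′»)] -/
def theta (x : E3) : E3 →ₗ[ℝ] E3 where
  toFun y := imVec (dexpIm x y * (exp (imQuat x))⁻¹)
  map_add' y y' := by rw [map_add, add_mul, imVec_add]
  map_smul' c y := by rw [map_smul, smul_mul_assoc, imVec_smul, RingHom.id_apply]

/-- `theta` unfolded. [cite: Balaban1989LargeFieldII, p.359] -/
theorem theta_apply (x y : E3) : theta x y = imVec (dexpIm x y * (exp (imQuat x))⁻¹) := rfl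

/-- The left quotient curve `s ↦ exp(ι(x+sy))·exp(ιx)⁻¹` takes unit values. [folklore] -/
private theorem norm_expLine_quot (x y : E3) (s : ℝ) : ‖exp (imQuat (x + s • y)) * (exp (imQuat x))⁻¹‖ = 1 := by
  rw [norm_mul, norm_inv, norm_exp_imQuat, norm_exp_imQuat, inv_one, mul_one]

/-- **THE LOGARITHM OF THE LEFT QUOTIENT CURVE**: `d/ds logVec(exp(ι(x+sy))·exp(ιx)⁻¹)|_{s=0} = theta x y`.
[cite: Balaban1989LargeFieldII, p.359] -/
theorem hasDerivAt_logVec_expLine (x y : E3) :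
    HasDerivAt (fun s : ℝ => logVec (exp (imQuat (x + s • y)) * (exp (imQuat x))⁻¹)) (theta x y) 0 := by
  have hd : HasDerivAt (fun s : ℝ => exp (imQuat (x + s • y)) * (exp (imQuat x))⁻¹) (dexpIm x y * (exp (imQuat x))⁻¹) 0 :=
    (hasDerivAt_exp_imQuat_line x y).mul_const _
  have h0 : exp (imQuat (x + (0 : ℝ) • y)) * (exp (imQuat x))⁻¹ = 1 := by
    rw [zero_smul, add_zero, mul_inv_cancel₀ (exp_imQuat_ne_zero x)]
  exact hasDerivAt_logVec_of_unit (norm_expLine_quot x y) h0 hd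

/-- **`theta x` IS INJECTIVE FOR `‖x‖ ≤ 1/2`**: if `imVec (D exp(ιy)·e^{−ιx}) = 0` then, the velocity of a unit curve through `1`
being purely imaginary, `D exp(ιy) = 0`, so `y = 0` (`dexpIm_injective`). [cite: Balaban1989LargeFieldII, p.359] -/
theorem theta_injective {x : E3} (hx : ‖x‖ ≤ 1 / 2) : Function.Injective (theta x) := by
  refine (injective_iff_map_eq_zero (theta x)).2 fun y hy => ?_
  rw [theta_apply] at hy
  have hd : HasDerivAt (fun s : ℝ => exp (imQuat (x + s • y)) * (exp (imQuat x))⁻¹) (dexpIm x y * (exp (imQuat x))⁻¹) 0 :=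
    (hasDerivAt_exp_imQuat_line x y).mul_const _
  have h0 : exp (imQuat (x + (0 : ℝ) • y)) * (exp (imQuat x))⁻¹ = 1 := by
    rw [zero_smul, add_zero, mul_inv_cancel₀ (exp_imQuat_ne_zero x)]
  have hre := re_eq_zero_of_unit (norm_expLine_quot x y) h0 hd
  have hw : dexpIm x y * (exp (imQuat x))⁻¹ = 0 := eq_zero_of_re_of_imVec hre hy
  have hw' : dexpIm x y = 0 := by
    have := congrArg (fun q => q * exp (imQuat x)) hw
    simpa only [inv_mul_cancel_right₀ (exp_imQuat_ne_zero x), zero_mul] using this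
  exact (injective_iff_map_eq_zero _).1 (dexpIm_injective hx) y hw'

/-- **`theta x` IS BIJECTIVE FOR `‖x‖ ≤ 1/2`** (an injective endomorphism of `ℝ³`). [cite: Balaban1989LargeFieldII, p.359] -/
theorem theta_bijective {x : E3} (hx : ‖x‖ ≤ 1 / 2) : Function.Bijective (theta x) :=
  ⟨theta_injective hx, LinearMap.surjective_of_injective (theta_injective hx)⟩

/-! ## §5 At the chart `su2Chart`: the bond curve and the gauge curve -/

/-- `su2Quat` commutes with inversion. [folklore] -/
private theorem su2Quat_inv (g : SU2) : su2Quat g⁻¹ = (su2Quat g)⁻¹ := by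
  have h : su2Quat g * su2Quat g⁻¹ = 1 := by rw [← su2Quat_mul, mul_inv_cancel, su2Quat_one]
  exact eq_inv_of_mul_eq_one_right h

/-- `su2Quat (exp i z) = exp(ιz)` for the chart `su2Chart`. [cite: Balaban1989LargeFieldII, (1.19) p.360] -/
theorem su2Quat_iexp (z : E3) : su2Quat (su2Chart.iexp z) = exp (imQuat z) := by
  rw [su2Chart_iexp, su2Quat_expPoint]

/-- **THE BOND CURVE** of the chart change: `chartCurve x y s = (1/i) log (exp i(x + sy) · (exp ix)⁻¹) ∈ ℝ³` — the left-multiplicative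
coordinate of the configuration `exp i(x+sy)·U(b)` relative to `exp(ix)·U(b)` on one bond. [cite: Balaban1989LargeFieldII, p.359] -/
def chartCurve (x y : E3) (s : ℝ) : E3 := su2Chart.ilog (su2Chart.iexp (x + s • y) * (su2Chart.iexp x)⁻¹)

/-- **`exp i(chartCurve s) · exp ix = exp i(x + sy)`** for EVERY `s` (the chart logarithm is a global right inverse,
`B15Prop1ChartSU2.iexp_ilog`). [cite: Balaban1989LargeFieldII, p.359] -/
theorem iexp_chartCurve_mul (x y : E3) (s : ℝ) :
    su2Chart.iexp (chartCurve x y s) * su2Chart.iexp x = su2Chart.iexp (x + s • y) := by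
  rw [chartCurve, iexp_ilog, inv_mul_cancel_right]

/-- `chartCurve x y 0 = 0`. [cite: Balaban1989LargeFieldII, p.359] -/
theorem chartCurve_zero (x y : E3) : chartCurve x y 0 = 0 := by
  rw [chartCurve, zero_smul, add_zero, mul_inv_cancel, su2Chart.ilog_one]

/-- **THE BOND CURVE HAS VELOCITY `theta x y` AT `s = 0`.** [cite: Balaban1989LargeFieldII, p.359] -/
theorem hasDerivAt_chartCurve (x y : E3) : HasDerivAt (chartCurve x y) (theta x y) 0 := by
  have heq : chartCurve x y = fun s => logVec (exp (imQuat (x + s • y)) * (exp (imQuat x))⁻¹) := by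
    funext s
    rw [chartCurve, su2Chart_ilog, su2Quat_mul, su2Quat_inv, su2Quat_iexp, su2Quat_iexp]
  rw [heq]
  exact hasDerivAt_logVec_expLine x y

/-- **THE GAUGE CURVE** of one bond: `gaugeCurve g l₁ l₂ s = (1/i) log (exp(isl₁)·g·exp(isl₂)⁻¹·g⁻¹)` — the left-multiplicative
coordinate of the gauge transform `u(b₋) g u(b₊)⁻¹`, `u = exp(isλ)`, `λ(b₋) = l₁`, `λ(b₊) = l₂`, relative to `g = V(b)`.
[cite: Balaban1989LargeFieldI, (1.77) p.194 («invariant with respect to the group of all gauge transformations defined on Λ»)] -/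
def gaugeCurve (g : SU2) (l₁ l₂ : E3) (s : ℝ) : E3 :=
  su2Chart.ilog (su2Chart.iexp (s • l₁) * g * (su2Chart.iexp (s • l₂))⁻¹ * g⁻¹)

/-- **`exp i(gaugeCurve s) · g = exp(isl₁) · g · exp(isl₂)⁻¹`** for every `s`. [cite: Balaban1989LargeFieldI, (1.77) p.194] -/
theorem iexp_gaugeCurve_mul (g : SU2) (l₁ l₂ : E3) (s : ℝ) :
    su2Chart.iexp (gaugeCurve g l₁ l₂ s) * g = su2Chart.iexp (s • l₁) * g * (su2Chart.iexp (s • l₂))⁻¹ := by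
  rw [gaugeCurve, iexp_ilog, inv_mul_cancel_right]

/-- `gaugeCurve g l₁ l₂ 0 = 0` (the identity transformation). [cite: Balaban1989LargeFieldI, (1.77) p.194] -/
theorem gaugeCurve_zero (g : SU2) (l₁ l₂ : E3) : gaugeCurve g l₁ l₂ 0 = 0 := by
  rw [gaugeCurve, zero_smul, zero_smul, su2Chart.iexp_zero, one_mul, inv_one, mul_one, mul_inv_cancel, su2Chart.ilog_one]

/-- `exp(−X)·exp(X) = 1` in `ℍ`, as an inverse: `(exp X)⁻¹ = exp(−X)`. [folklore] -/
private theorem exp_inv_eq (X : ℍ) : (exp X)⁻¹ = exp (-X) :=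
  (eq_inv_of_mul_eq_one_left (exp_neg_mul_exp_eq_one (𝕂 := ℝ) X)).symm

/-- The quaternion form of the gauge curve's argument: `exp(s·ιl₁)·G·exp(s·(−ιl₂))·G⁻¹`, `G = su2Quat g`. [folklore] -/
private theorem su2Quat_gauge_arg (g : SU2) (l₁ l₂ : E3) (s : ℝ) :
    su2Quat (su2Chart.iexp (s • l₁) * g * (su2Chart.iexp (s • l₂))⁻¹ * g⁻¹) =
      exp (s • imQuat l₁) * su2Quat g * exp (s • (-imQuat l₂)) * (su2Quat g)⁻¹ := by
  rw [su2Quat_mul, su2Quat_mul, su2Quat_mul, su2Quat_inv, su2Quat_inv, su2Quat_iexp, su2Quat_iexp, map_smul, map_smul,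
    exp_inv_eq, smul_neg]

/-- The quaternion gauge curve takes unit values. [folklore] -/
private theorem norm_gauge_arg (g : SU2) (l₁ l₂ : E3) (s : ℝ) :
    ‖exp (s • imQuat l₁) * su2Quat g * exp (s • (-imQuat l₂)) * (su2Quat g)⁻¹‖ = 1 := by
  have h1 : ‖exp (s • imQuat l₁)‖ = 1 := by rw [← map_smul, norm_exp_imQuat]
  have h2 : ‖exp (s • (-imQuat l₂))‖ = 1 := by rw [← map_neg, ← map_smul, norm_exp_imQuat]
  rw [norm_mul, norm_mul, norm_mul, norm_inv, h1, h2, norm_su2Quat]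
  norm_num

/-- **THE GAUGE CURVE HAS VELOCITY `l₁ − Ad_g l₂` AT `s = 0`** (`Ad_g = adSU2 g`: the infinitesimal gauge transformation
`λ(b₋) − Ad_{V(b)} λ(b₊)` of the bond variable `V(b) = g`). [cite: Balaban1989LargeFieldI, (1.77) p.194] -/
theorem hasDerivAt_gaugeCurve (g : SU2) (l₁ l₂ : E3) : HasDerivAt (gaugeCurve g l₁ l₂) (l₁ - adSU2 g l₂) 0 := by
  have hG0 : su2Quat g ≠ 0 := su2Quat_ne_zero g
  -- the quaternion curve and its velocity
  have hd1 : HasDerivAt (fun s : ℝ => exp (s • imQuat l₁)) (imQuat l₁) 0 := by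
    simpa using hasDerivAt_exp_smul_const' (𝕂 := ℝ) (imQuat l₁) (0 : ℝ)
  have hd2 : HasDerivAt (fun s : ℝ => exp (s • (-imQuat l₂))) (-imQuat l₂) 0 := by
    simpa using hasDerivAt_exp_smul_const' (𝕂 := ℝ) (-imQuat l₂) (0 : ℝ)
  have hd : HasDerivAt (fun s : ℝ => exp (s • imQuat l₁) * su2Quat g * exp (s • (-imQuat l₂)) * (su2Quat g)⁻¹)
      (imQuat l₁ - su2Quat g * imQuat l₂ * (su2Quat g)⁻¹) 0 := by
    have h := ((hd1.mul_const (su2Quat g)).mul hd2).mul_const (su2Quat g)⁻¹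
    refine h.congr_deriv ?_
    simp only [zero_smul, NormedSpace.exp_zero, one_mul, mul_one]
    rw [add_mul, mul_assoc (imQuat l₁) (su2Quat g) (su2Quat g)⁻¹, mul_inv_cancel₀ hG0, mul_one, mul_neg, neg_mul,
      sub_eq_add_neg]
  have h0 : exp ((0 : ℝ) • imQuat l₁) * su2Quat g * exp ((0 : ℝ) • (-imQuat l₂)) * (su2Quat g)⁻¹ = 1 := by
    simp only [zero_smul, NormedSpace.exp_zero, one_mul, mul_one, mul_inv_cancel₀ hG0]
  have hlog := hasDerivAt_logVec_of_unit (norm_gauge_arg g l₁ l₂) h0 hd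
  have heq : gaugeCurve g l₁ l₂ =
      fun s => logVec (exp (s • imQuat l₁) * su2Quat g * exp (s • (-imQuat l₂)) * (su2Quat g)⁻¹) := by
    funext s
    rw [gaugeCurve, su2Chart_ilog, su2Quat_gauge_arg]
  rw [heq]
  refine hlog.congr_deriv ?_
  rw [imVec_sub, imVec_imQuat, ← adSU2_apply]

/-! ## §6 The adjoint action is an action (inverting the infinitesimal gauge condition at a fresh end) -/

/-- `re (a·b) = re (b·a)` in `ℍ`. [folklore] -/
private theorem re_mul_comm (a b : ℍ) : (a * b).re = (b * a).re := by
  simp only [Quaternion.re_mul]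
  ring

/-- `ι(Ad_g X) = q·ιX·q⁻¹`, `q = su2Quat g`: the conjugate of a pure quaternion by a unit is pure (pv26/g2's private lemma of
`B15Prop1ChartSU2`, restated for use). [cite: Balaban1989LargeFieldI, (1.77) p.194] -/
theorem imQuat_adSU2 (g : SU2) (X : E3) : imQuat (adSU2 g X) = su2Quat g * imQuat X * (su2Quat g)⁻¹ := by
  rw [adSU2_apply, imQuat_imVec]
  set p := su2Quat g * imQuat X * (su2Quat g)⁻¹ with hp
  have hre : p.re = 0 := by
    rw [hp, re_mul_comm, ← mul_assoc, inv_mul_cancel₀ (su2Quat_ne_zero g), one_mul, imQuat_re]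
  have := Quaternion.re_add_im p
  rw [hre] at this
  simpa using this

/-- `Ad_1 = id`. [cite: Balaban1989LargeFieldI, (1.77) p.194] -/
@[simp] theorem adSU2_one_apply (X : E3) : adSU2 1 X = X := by
  rw [adSU2_apply, su2Quat_one, one_mul, inv_one, mul_one, imVec_imQuat]

/-- `Ad_g ∘ Ad_h = Ad_{gh}`. [cite: Balaban1989LargeFieldI, (1.77) p.194] -/
theorem adSU2_adSU2 (g h : SU2) (X : E3) : adSU2 g (adSU2 h X) = adSU2 (g * h) X := by
  apply imQuat_injective
  rw [imQuat_adSU2, imQuat_adSU2, imQuat_adSU2, su2Quat_mul, mul_inv_rev]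
  simp only [mul_assoc]

/-- `Ad_{g⁻¹} (Ad_g X) = X`. [cite: Balaban1989LargeFieldI, (1.77) p.194] -/
@[simp] theorem adSU2_inv_adSU2 (g : SU2) (X : E3) : adSU2 g⁻¹ (adSU2 g X) = X := by
  rw [adSU2_adSU2, inv_mul_cancel, adSU2_one_apply]

/-- `Ad_g (Ad_{g⁻¹} X) = X`. [cite: Balaban1989LargeFieldI, (1.77) p.194] -/
@[simp] theorem adSU2_adSU2_inv (g : SU2) (X : E3) : adSU2 g (adSU2 g⁻¹ X) = X := by
  rw [adSU2_adSU2, mul_inv_cancel, adSU2_one_apply]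

end Literature.MathematicalPhysics.QuantumFieldTheory.Balaban1983to89.B15Prop1ChartCalculusSU2

end
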